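import Summits.NavierStokesRegularity.NavierStokesRegularity.Theses.RellichScar
import Summits.NavierStokesRegularity.NavierStokesRegularity.Theorems.ScarRigidity.Negative.LogicAndLoadBearing
import Summits.NavierStokesRegularity.NavierStokesRegularity.Theorems.RellichScarDefs
import Summits.NavierStokesRegularity.NavierStokesRegularity.Theorems.RellichScarScarRigidityFarFieldAllOrders
import Summits.NavierStokesRegularity.NavierStokesRegularity.Theorems.RellichScarScarRigidityApexRegularityExchange
import Literature.Analysis.FluidPDE.TypeIAncientMild
import Literature.Analysis.FluidPDE.SwirlTransportProofs
import Literature.Analysis.FluidPDE.PeriodicCylinderWordNorms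
import Literature.Analysis.FluidPDE.PeriodicCylinderNeumannWeakTangential
import HarnessLib

/-!
# `ScarRigidity` — line `SketchIdeator6` (generator–hull), stub `stub_rotationGeneratorFlat` (S3a)
# (crux stmt-NavierStokesRegularity-11717, route RellichScar)

**S3a — an axisymmetric scar makes the rotation generator flat.**  For a smooth apex profile `V` (classical on
the open backward slab, scale-invariant package `ScaleInvariantBounds V Q`) all of whose rotation conjugates
`R_θ V(t, R_{−θ}x)` have the same scar as `V`, the ROTATION GENERATOR `r(t,x) = J V(t,x) − ∇V(t,x)·(J x)`
(`J = rotGen = (d/dθ) R_θ|₀`) obeys `‖r(t,x)‖ ≤ K (−t)/(‖x‖+√(−t))³` on the whole slab.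

Proof. (1) *Zero scar of `r`* (`tendsto_rotDefect`): for `x₀ ≠ 0` the orbit `Φ_s(θ) = R_θ V(s, R_{−θ}x₀)` has
`Φ_s'(θ) = R_θ r(s, R_{−θ}x₀)` (`hasDerivAt_rotConj`), which is `M|θ|`-close to `r(s,x₀)` uniformly in `s < 0`
(the package bounds on `V, ∇V, ∇²V` make `r(s,·)` uniformly Lipschitz on `B(x₀, ‖x₀‖/2)`, and
`‖R_θ w − w‖ ≤ |θ|‖w‖`); the mean value inequality on `[0, κ]` gives `κ‖r(s,x₀)‖ ≤ ‖Φ_s(κ) − V(s,x₀)‖ + Mκ²`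
(`rotDefect_le_of_orbit`), the scar at the angle `κ` read pointwise (`tendsto_sub_of_sameScar`) kills the first
term as `s ↑ 0`, and `κ` is arbitrary.  (2) *Mean value in time* (`norm_rotDefect_le_far`, the pattern of
`stub_farFieldOfScar`): `‖∂ₛ r(s,x)‖ ≤ ‖∂ₜV‖ + ‖∇∂ₜV‖‖x‖ ≤ (L₀+L₁)/‖x‖³` (package `n = 0, 1`, FIRST time
derivatives only, via `deriv_iteratedFDeriv_slice`), so `‖r(t,x)‖ ≤ (L₀+L₁)(−t)/‖x‖³` for `x ≠ 0`.
(3) *Weights*: `(−t)/‖x‖³ ≤ 8(−t)/(‖x‖+√(−t))³` off the core `‖x‖ < √(−t)`; on the core the apex bounds give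
`‖r‖ ≤ (L₀+L₁)/(‖x‖+√(−t)) ≤ 8(L₀+L₁)(−t)/(‖x‖+√(−t))³`.  Folklore calculus over Mathlib
(`Convex.norm_image_sub_le_of_norm_hasDerivWithin_le`, `HasFDerivAt.clm_apply`) and the tree's rotation algebra
(`hasDerivAt_rotZ`, `norm_rotGen_le_norm`, `PeriodicCylinder.norm_rotZ_sub_self_le`).
-/

noncomputable section

open Set Filter Function MeasureTheory Metric TopologicalSpace
open scoped Topology NNReal InnerProductSpace RealInnerProductSpace ContDiff

set_option linter.dupNamespace false -- D-0017: `Summit.<S>.<S>.…` repeats the summit name by design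

namespace Summit.NavierStokesRegularity.NavierStokesRegularity.Theorems.RellichScarScarRigidity

open Literature.Analysis.FluidPDE
open Summit.NavierStokesRegularity.NavierStokesRegularity.Theses.RellichScar
open Summit.NavierStokesRegularity.NavierStokesRegularity.Theorems.ScarRigidity.Negative

/-- Physical space (the notation of the route file, in which the registered stub below is stated). -/
local notation "ℝ³" => EuclideanSpace ℝ (Fin 3)

/-! ## Rotation calculus: the conjugation orbit and the rotation defect -/

/-- `R_φ v = v + sin φ · J v + (1 − cos φ) · J(J v)` (`−J²` is the horizontal projection). [folklore] -/
theorem rotZ_eq_rotGen_expand (φ : ℝ) (v : ℝ³) :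
    rotZ φ v = v + Real.sin φ • rotGen v + (1 - Real.cos φ) • rotGen (rotGen v) := by
  ext i; fin_cases i <;> simp [rotGen] <;> ring

/-- The velocity of `θ ↦ R_{−θ} x` is `−J(R_{−θ} x)` (that of `θ ↦ R_θ x` is `J(R_θ x)`). [folklore] -/
theorem hasDerivAt_rotZ_neg (x : ℝ³) (θ : ℝ) :
    HasDerivAt (fun φ => rotZ (-φ) x) (-rotGen (rotZ (-θ) x)) θ := by
  have h : HasDerivAt (fun φ => rotZ φ x) (rotGen (rotZ (-θ) x)) (-θ) := by
    convert hasDerivAt_rotZ x (-θ) using 1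
    ext i; fin_cases i <;> simp [rotGen] <;> ring
  simpa [Function.comp_def] using h.scomp θ (hasDerivAt_neg θ)

/-- **Derivative of the conjugation orbit** `φ ↦ R_φ f(R_{−φ} x₀)` at `θ`: it is `R_θ (J f(y) − Df(y)[J y])` with
`y = R_{−θ} x₀` (chain rule; `R_φ v = v + sin φ Jv + (1 − cos φ) J²v`). [folklore] -/
theorem hasDerivAt_rotConj {f : ℝ³ → ℝ³} (x₀ : ℝ³)
    (θ : ℝ) (hf : DifferentiableAt ℝ f (rotZ (-θ) x₀)) :
    HasDerivAt (fun φ => rotZ φ (f (rotZ (-φ) x₀)))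
      (rotZ θ (rotGen (f (rotZ (-θ) x₀)) - fderiv ℝ f (rotZ (-θ) x₀) (rotGen (rotZ (-θ) x₀)))) θ := by
  set y := rotZ (-θ) x₀ with hy
  have hg : HasDerivAt (fun φ => f (rotZ (-φ) x₀)) (-(fderiv ℝ f y (rotGen y))) θ := by
    simpa [Function.comp_def] using hf.hasFDerivAt.comp_hasDerivAt θ (hasDerivAt_rotZ_neg x₀ θ)
  have hJg : HasDerivAt (fun φ => rotGen (f (rotZ (-φ) x₀))) (rotGen (-(fderiv ℝ f y (rotGen y)))) θ := by
    simpa [Function.comp_def] using rotGenL.hasFDerivAt.comp_hasDerivAt θ hg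
  have hJJg : HasDerivAt (fun φ => rotGen (rotGen (f (rotZ (-φ) x₀))))
      (rotGen (rotGen (-(fderiv ℝ f y (rotGen y))))) θ := by
    simpa [Function.comp_def] using rotGenL.hasFDerivAt.comp_hasDerivAt θ hJg
  have h1cos : HasDerivAt (fun φ => 1 - Real.cos φ) (Real.sin θ) θ := by
    simpa using (Real.hasDerivAt_cos θ).const_sub 1
  have hsum := (hg.add ((Real.hasDerivAt_sin θ).smul hJg)).add (h1cos.smul hJJg)
  have hfun : (fun φ => rotZ φ (f (rotZ (-φ) x₀))) = fun φ => f (rotZ (-φ) x₀) +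
      Real.sin φ • rotGen (f (rotZ (-φ) x₀)) + (1 - Real.cos φ) • rotGen (rotGen (f (rotZ (-φ) x₀))) :=
    funext fun φ => rotZ_eq_rotGen_expand φ _
  rw [hfun]
  refine hsum.congr_deriv ?_
  ext i; fin_cases i <;> simp [rotGen] <;> ring

/-- **Derivative of the rotation defect** `r_f : z ↦ J f(z) − Df(z)[J z]` of a smooth field: `r_f` is
differentiable with `‖D r_f(z)‖ ≤ 2‖Df(z)‖ + ‖D²f(z)‖ ‖z‖`
(`D r_f(z) = J∘Df(z) − Df(z)∘J − D²f(z)(·, Jz)` and `‖J‖ ≤ 1`). [folklore] -/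
theorem hasFDerivAt_rotDefect {f : ℝ³ → ℝ³} (hf : ContDiff ℝ ∞ f)
    (z : ℝ³) : ∃ F : ℝ³ →L[ℝ] ℝ³,
      HasFDerivAt (fun y => rotGen (f y) - fderiv ℝ f y (rotGen y)) F z ∧
      ‖F‖ ≤ 2 * ‖fderiv ℝ f z‖ + ‖fderiv ℝ (fderiv ℝ f) z‖ * ‖z‖ := by
  have hJ : ‖rotGenL‖ ≤ 1 :=
    ContinuousLinearMap.opNorm_le_bound _ zero_le_one fun v => by simpa using norm_rotGen_le_norm v
  have hd : Differentiable ℝ f := hf.differentiable (by simp)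
  have hd2 : Differentiable ℝ (fderiv ℝ f) := (hf.fderiv_right (m := ∞) le_rfl).differentiable (by simp)
  have h2 : HasFDerivAt (fun y => fderiv ℝ f y (rotGen y))
      ((fderiv ℝ f z).comp rotGenL + (fderiv ℝ (fderiv ℝ f) z).flip (rotGen z)) z := by
    simpa using (hd2 z).hasFDerivAt.clm_apply (rotGenL.hasFDerivAt (x := z))
  refine ⟨_, (rotGenL.hasFDerivAt.comp z (hd z).hasFDerivAt).sub h2, ?_⟩
  have h1 : ‖rotGenL.comp (fderiv ℝ f z)‖ ≤ ‖fderiv ℝ f z‖ :=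
    (ContinuousLinearMap.opNorm_comp_le _ _).trans (mul_le_of_le_one_left (norm_nonneg _) hJ)
  have h2 : ‖(fderiv ℝ f z).comp rotGenL‖ ≤ ‖fderiv ℝ f z‖ :=
    (ContinuousLinearMap.opNorm_comp_le _ _).trans (mul_le_of_le_one_right (norm_nonneg _) hJ)
  have h3 : ‖(fderiv ℝ (fderiv ℝ f) z).flip (rotGen z)‖ ≤ ‖fderiv ℝ (fderiv ℝ f) z‖ * ‖z‖ := by
    refine ((fderiv ℝ (fderiv ℝ f) z).flip.le_opNorm _).trans ?_
    rw [ContinuousLinearMap.opNorm_flip]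
    exact mul_le_mul_of_nonneg_left (norm_rotGen_le_norm z) (norm_nonneg _)
  calc _ ≤ ‖rotGenL.comp (fderiv ℝ f z)‖ +
        ‖(fderiv ℝ f z).comp rotGenL + (fderiv ℝ (fderiv ℝ f) z).flip (rotGen z)‖ := norm_sub_le _ _
    _ ≤ ‖fderiv ℝ f z‖ + (‖fderiv ℝ f z‖ + ‖fderiv ℝ (fderiv ℝ f) z‖ * ‖z‖) :=
        add_le_add h1 ((norm_add_le _ _).trans (add_le_add h2 h3))
    _ = 2 * ‖fderiv ℝ f z‖ + ‖fderiv ℝ (fderiv ℝ f) z‖ * ‖z‖ := by ring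

/-- **The generator is controlled by the orbit increment.**  For a smooth `f` with `‖f‖ ≤ A₀`, `‖Df‖ ≤ A`,
`‖D²f‖ ≤ B` on the ball `B(x₀, ‖x₀‖/2)` and `0 < κ ≤ 1/4`:
`κ ‖J f(x₀) − Df(x₀)[J x₀]‖ ≤ ‖R_κ f(R_{−κ}x₀) − f(x₀)‖ + M κ²`, `M = A₀ + A‖x₀‖ + (2A + 2B‖x₀‖)‖x₀‖`
(mean value inequality on `[0, κ]` for `θ ↦ R_θ f(R_{−θ}x₀) − θ · (J f(x₀) − Df(x₀)[J x₀])`). [folklore] -/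
theorem rotDefect_le_of_orbit {f : ℝ³ → ℝ³} (hf : ContDiff ℝ ∞ f)
    {x₀ : ℝ³} (hx₀ : x₀ ≠ 0)
    {A₀ A B : ℝ} (hA : 0 ≤ A) (hB : 0 ≤ B) (h₀ : ∀ z ∈ ball x₀ (‖x₀‖ / 2), ‖f z‖ ≤ A₀)
    (h₁ : ∀ z ∈ ball x₀ (‖x₀‖ / 2), ‖fderiv ℝ f z‖ ≤ A)
    (h₂ : ∀ z ∈ ball x₀ (‖x₀‖ / 2), ‖fderiv ℝ (fderiv ℝ f) z‖ ≤ B) {κ : ℝ} (hκ0 : 0 < κ) (hκ : κ ≤ 1 / 4) :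
    κ * ‖rotGen (f x₀) - fderiv ℝ f x₀ (rotGen x₀)‖ ≤ ‖rotZ κ (f (rotZ (-κ) x₀)) - f x₀‖ +
      (A₀ + A * ‖x₀‖ + (2 * A + B * (2 * ‖x₀‖)) * ‖x₀‖) * κ ^ 2 := by
  set ρ : ℝ := ‖x₀‖ with hρ
  have hρ0 : 0 < ρ := norm_pos_iff.2 hx₀
  set r : ℝ³ → ℝ³ := fun z => rotGen (f z) - fderiv ℝ f z (rotGen z)
    with hr
  set M₁ : ℝ := 2 * A + B * (2 * ρ) with hM₁
  have hM₁0 : 0 ≤ M₁ := by positivity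
  set M : ℝ := A₀ + A * ρ + M₁ * ρ with hM
  -- (i) `r` is `M₁`-Lipschitz on the ball
  have hlip : ∀ y ∈ ball x₀ (ρ / 2), ‖r y - r x₀‖ ≤ M₁ * ‖y - x₀‖ := by
    intro y hy
    choose F hF hFle using hasFDerivAt_rotDefect hf
    refine (convex_ball x₀ (ρ / 2)).norm_image_sub_le_of_norm_hasFDerivWithin_le
      (fun z _ => (hF z).hasFDerivWithinAt) (fun z hz => ?_) (mem_ball_self (half_pos hρ0)) hy
    have hz2 : ‖z‖ ≤ 2 * ρ := by linarith [mem_ball_iff_norm.1 hz, norm_le_norm_add_norm_sub' z x₀]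
    exact (hFle z).trans (add_le_add (mul_le_mul_of_nonneg_left (h₁ z hz) zero_le_two)
      (mul_le_mul (h₂ z hz) hz2 (norm_nonneg _) hB))
  -- (ii) the orbit corrected by `θ • r x₀`, and the size of its derivative on `[0, κ]`
  have horb : ∀ θ ∈ Icc (0 : ℝ) κ, HasDerivWithinAt (fun φ => rotZ φ (f (rotZ (-φ) x₀)) - φ • r x₀)
      (rotZ θ (r (rotZ (-θ) x₀)) - r x₀) (Icc 0 κ) θ := by
    intro θ _
    have hd : DifferentiableAt ℝ f (rotZ (-θ) x₀) := (hf.differentiable (by simp)) _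
    have h2 : HasDerivAt (fun φ : ℝ => φ • r x₀) (r x₀) θ := by
      simpa using (hasDerivAt_id θ).smul_const (r x₀)
    exact ((hasDerivAt_rotConj x₀ θ hd).sub h2).hasDerivWithinAt
  have hbd : ∀ θ ∈ Icc (0 : ℝ) κ, ‖rotZ θ (r (rotZ (-θ) x₀)) - r x₀‖ ≤ M * κ := by
    intro θ hθ
    have hθabs : |θ| ≤ κ := abs_le.2 ⟨by linarith [hθ.1], hθ.2⟩
    have hyx : ‖rotZ (-θ) x₀ - x₀‖ ≤ |θ| * ρ := by
      simpa [abs_neg] using PeriodicCylinder.norm_rotZ_sub_self_le (-θ) x₀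
    have hyball : rotZ (-θ) x₀ ∈ ball x₀ (ρ / 2) :=
      mem_ball_iff_norm.2 (by nlinarith [mul_le_mul_of_nonneg_right hθabs hρ0.le])
    have hry : ‖r (rotZ (-θ) x₀)‖ ≤ A₀ + A * ρ := by
      calc ‖r (rotZ (-θ) x₀)‖
          ≤ ‖rotGen (f (rotZ (-θ) x₀))‖ + ‖fderiv ℝ f (rotZ (-θ) x₀) (rotGen (rotZ (-θ) x₀))‖ :=
            norm_sub_le _ _
        _ ≤ ‖f (rotZ (-θ) x₀)‖ + ‖fderiv ℝ f (rotZ (-θ) x₀)‖ * ‖rotGen (rotZ (-θ) x₀)‖ :=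
            add_le_add (norm_rotGen_le_norm _) (ContinuousLinearMap.le_opNorm _ _)
        _ ≤ A₀ + A * ρ := add_le_add (h₀ _ hyball)
            (mul_le_mul (h₁ _ hyball) ((norm_rotGen_le_norm _).trans (norm_rotZ _ _).le) (norm_nonneg _) hA)
    calc ‖rotZ θ (r (rotZ (-θ) x₀)) - r x₀‖
        ≤ ‖rotZ θ (r (rotZ (-θ) x₀)) - r (rotZ (-θ) x₀)‖ + ‖r (rotZ (-θ) x₀) - r x₀‖ :=
          norm_sub_le_norm_sub_add_norm_sub _ _ _
      _ ≤ |θ| * ‖r (rotZ (-θ) x₀)‖ + M₁ * ‖rotZ (-θ) x₀ - x₀‖ :=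
          add_le_add (PeriodicCylinder.norm_rotZ_sub_self_le θ _) (hlip _ hyball)
      _ ≤ κ * (A₀ + A * ρ) + M₁ * (κ * ρ) := add_le_add (mul_le_mul hθabs hry (norm_nonneg _) hκ0.le)
          (mul_le_mul_of_nonneg_left (hyx.trans (mul_le_mul_of_nonneg_right hθabs hρ0.le)) hM₁0)
      _ = M * κ := by rw [hM]; ring
  -- (iii) mean value inequality on `[0, κ]`
  have hmvt := (convex_Icc (0 : ℝ) κ).norm_image_sub_le_of_norm_hasDerivWithin_le horb hbd
    (left_mem_Icc.2 hκ0.le) (right_mem_Icc.2 hκ0.le)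
  simp only [neg_zero, rotZ_zero, zero_smul, sub_zero, Real.norm_eq_abs, abs_of_pos hκ0] at hmvt
  calc κ * ‖r x₀‖ = ‖κ • r x₀‖ := by rw [norm_smul, Real.norm_eq_abs, abs_of_pos hκ0]
    _ = ‖(rotZ κ (f (rotZ (-κ) x₀)) - f x₀) - (rotZ κ (f (rotZ (-κ) x₀)) - κ • r x₀ - f x₀)‖ := by
        congr 1; abel
    _ ≤ ‖rotZ κ (f (rotZ (-κ) x₀)) - f x₀‖ + ‖rotZ κ (f (rotZ (-κ) x₀)) - κ • r x₀ - f x₀‖ :=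
        norm_sub_le _ _
    _ ≤ ‖rotZ κ (f (rotZ (-κ) x₀)) - f x₀‖ + M * κ ^ 2 := by
        rw [sq, ← mul_assoc]; exact add_le_add le_rfl hmvt

/-! ## The profile: conjugates, the package, the zero scar of the generator, mean value in time, the stub -/

/-- Rotation conjugates of a field jointly smooth on the slab are jointly smooth on the slab. [folklore] -/
theorem isSmoothSpaceTimeOn_rotConj {V : ℝ → ℝ³ → ℝ³}
    (hsm : IsSmoothSpaceTimeOn (Iio (0 : ℝ)) V) (θ : ℝ) :
    IsSmoothSpaceTimeOn (Iio (0 : ℝ)) fun t x => rotZ θ (V t (rotZ (-θ) x)) := by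
  have hΦ : ContDiff ℝ ∞ fun z : ℝ × ℝ³ => (z.1, rotZL (-θ) z.2) :=
    contDiff_fst.prodMk ((rotZL (-θ)).contDiff.comp contDiff_snd)
  have h1 : ContDiffOn ℝ ∞ (uncurry V ∘ fun z : ℝ × ℝ³ => (z.1, rotZL (-θ) z.2))
      (Iio (0 : ℝ) ×ˢ univ) := ContDiffOn.comp hsm hΦ.contDiffOn fun z hz => ⟨hz.1, mem_univ _⟩
  exact ((rotZL θ).contDiff.comp_contDiffOn h1).congr fun z _ => rfl

/-- **The package, unpacked at orders `0, 1, 2`**: `‖V‖ ≤ L₀/a`, `‖∇V‖ ≤ L₁/a²`, `‖∇²V‖ ≤ L₂/a³`,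
`‖∂ₜV‖ ≤ L₀/a³`, `‖∇∂ₜV‖ ≤ L₁/a⁴` with `a = ‖x‖+√(−t)` and `0 ≤ Lᵢ` (exchange `∂ₜ∇ⁿ = ∇ⁿ∂ₜ` of the tree,
`deriv_iteratedFDeriv_slice`). [folklore] -/
theorem package_orders_le_two {V : ℝ → ℝ³ → ℝ³}
    {Q : ℝ → ℝ³ → ℝ}
    (hsm : IsSmoothSpaceTimeOn (Iio (0 : ℝ)) V) (hB : ScaleInvariantBounds V Q) :
    ∃ L₀ L₁ L₂ : ℝ, 0 ≤ L₀ ∧ 0 ≤ L₁ ∧ 0 ≤ L₂ ∧ ∀ t < 0, ∀ x : ℝ³,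
      (‖V t x‖ ≤ L₀ / (‖x‖ + Real.sqrt (-t)) ∧ ‖fderiv ℝ (V t) x‖ ≤ L₁ / (‖x‖ + Real.sqrt (-t)) ^ 2 ∧
        ‖fderiv ℝ (fderiv ℝ (V t)) x‖ ≤ L₂ / (‖x‖ + Real.sqrt (-t)) ^ 3) ∧
      (‖deriv (fun s => V s x) t‖ ≤ L₀ / (‖x‖ + Real.sqrt (-t)) ^ 3 ∧
        ‖fderiv ℝ (fun y => deriv (fun s => V s y) t) x‖ ≤ L₁ / (‖x‖ + Real.sqrt (-t)) ^ 4) := by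
  obtain ⟨⟨L₀, h0⟩, ⟨L₁, h1⟩, ⟨L₂, h2⟩⟩ := And.intro (hB 0) (And.intro (hB 1) (hB 2))
  refine ⟨L₀, L₁, L₂, nonneg_of_timeDeriv_bound fun t ht x => (h0 t ht x).2.2,
    nonneg_of_timeDeriv_bound fun t ht x => (h1 t ht x).2.2,
    nonneg_of_timeDeriv_bound fun t ht x => (h2 t ht x).2.2, fun t ht x => ⟨⟨?_, ?_, ?_⟩, ?_, ?_⟩⟩
  · simpa using (h0 t ht x).1
  · simpa using (h1 t ht x).1
  · calc ‖fderiv ℝ (fderiv ℝ (V t)) x‖ = ‖iteratedFDeriv ℝ 1 (fderiv ℝ (V t)) x‖ :=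
          (norm_iteratedFDeriv_one (𝕜 := ℝ) _).symm
      _ = ‖iteratedFDeriv ℝ 2 (V t) x‖ := norm_iteratedFDeriv_fderiv
      _ ≤ L₂ / (‖x‖ + Real.sqrt (-t)) ^ 3 := by simpa using (h2 t ht x).1
  · simpa [deriv_iteratedFDeriv_slice hsm isOpen_Iio 0 ht x] using (h0 t ht x).2.2
  · simpa [deriv_iteratedFDeriv_slice hsm isOpen_Iio 1 ht x] using (h1 t ht x).2.2

/-- **Zero scar of the rotation generator.**  If all rotation conjugates of the jointly smooth `V` have the same
scar as `V` and `‖V‖ ≤ L₀/a`, `‖∇V‖ ≤ L₁/a²`, `‖∇²V‖ ≤ L₂/a³` (`a = ‖x‖+√(−t)`), then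
`J V(s,x₀) − ∇V(s,x₀)·(J x₀) → 0` as `s ↑ 0`, for every `x₀ ≠ 0`. [folklore] -/
theorem tendsto_rotDefect {V : ℝ → ℝ³ → ℝ³}
    (hsm : IsSmoothSpaceTimeOn (Iio (0 : ℝ)) V)
    {L₀ L₁ L₂ : ℝ} (hL₀ : 0 ≤ L₀) (hL₁ : 0 ≤ L₁) (hL₂ : 0 ≤ L₂)
    (hb : ∀ t < 0, ∀ x : ℝ³, ‖V t x‖ ≤ L₀ / (‖x‖ + Real.sqrt (-t)) ∧
      ‖fderiv ℝ (V t) x‖ ≤ L₁ / (‖x‖ + Real.sqrt (-t)) ^ 2 ∧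
      ‖fderiv ℝ (fderiv ℝ (V t)) x‖ ≤ L₂ / (‖x‖ + Real.sqrt (-t)) ^ 3)
    (hax : ∀ θ : ℝ, SameScar (fun t x => rotZ θ (V t (rotZ (-θ) x))) V)
    {x₀ : ℝ³} (hx₀ : x₀ ≠ 0) :
    Tendsto (fun s => rotGen (V s x₀) - fderiv ℝ (V s) x₀ (rotGen x₀)) (𝓝[<] (0 : ℝ)) (𝓝 0) := by
  set ρ : ℝ := ‖x₀‖ with hρ
  have hρ2 : 0 < ρ / 2 := half_pos (norm_pos_iff.2 hx₀)
  -- on the ball `B(x₀, ρ/2)` one has `ρ/2 ≤ ‖z‖`, whence bounds uniform in `s < 0`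
  have hden : ∀ {L : ℝ} (k : ℕ), 0 ≤ L → ∀ s < (0 : ℝ), ∀ z ∈ ball x₀ (ρ / 2),
      L / (‖z‖ + Real.sqrt (-s)) ^ k ≤ L / (ρ / 2) ^ k := by
    intro L k hL s _ z hz
    refine div_le_div_of_nonneg_left hL (pow_pos hρ2 k) (pow_le_pow_left₀ hρ2.le ?_ k)
    linarith [mem_ball_iff_norm'.1 hz, norm_le_norm_add_norm_sub' x₀ z, Real.sqrt_nonneg (-s)]
  set M : ℝ := L₀ / (ρ / 2) + L₁ / (ρ / 2) ^ 2 * ρ + (2 * (L₁ / (ρ / 2) ^ 2) + L₂ / (ρ / 2) ^ 3 * (2 * ρ)) * ρ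
    with hM
  have hM0 : 0 ≤ M := by positivity
  have key : ∀ s < (0 : ℝ), ∀ κ : ℝ, 0 < κ → κ ≤ 1 / 4 →
      κ * ‖rotGen (V s x₀) - fderiv ℝ (V s) x₀ (rotGen x₀)‖ ≤ ‖rotZ κ (V s (rotZ (-κ) x₀)) - V s x₀‖ + M * κ ^ 2 :=
    fun s hs κ hκ0 hκ =>
    rotDefect_le_of_orbit (hsm.contDiff_slice (t := s) hs) hx₀ (by positivity) (by positivity)
      (fun z hz => (hb s hs z).1.trans (by simpa using hden 1 hL₀ s hs z hz))
      (fun z hz => (hb s hs z).2.1.trans (hden 2 hL₁ s hs z hz))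
      (fun z hz => (hb s hs z).2.2.trans (hden 3 hL₂ s hs z hz)) hκ0 hκ
  -- `ε`-argument: choose the angle `κ` from `ε`, then let `s ↑ 0` in the scar at the angle `κ`
  refine NormedAddGroup.tendsto_nhds_zero.2 fun ε hε => ?_
  set κ : ℝ := min (1 / 4) (ε / (2 * (M + 1))) with hκdef
  have hκ0 : 0 < κ := lt_min (by norm_num) (by positivity)
  have hMκ : M * κ < ε / 2 := by
    refine (mul_le_mul_of_nonneg_left (min_le_right _ _) hM0).trans_lt ?_
    rw [mul_div_assoc', div_lt_div_iff₀ (by positivity) two_pos]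
    nlinarith
  have hlim := tendsto_sub_of_sameScar (isSmoothSpaceTimeOn_rotConj hsm κ) hsm (hax κ) hx₀
  filter_upwards [NormedAddGroup.tendsto_nhds_zero.1 hlim (κ * (ε / 2)) (by positivity), self_mem_nhdsWithin]
    with s hs hs0
  have h1 : κ * ‖rotGen (V s x₀) - fderiv ℝ (V s) x₀ (rotGen x₀)‖ < κ * ε := by
    calc _ ≤ ‖rotZ κ (V s (rotZ (-κ) x₀)) - V s x₀‖ + M * κ ^ 2 := key s hs0 κ hκ0 (min_le_left _ _)
      _ < κ * (ε / 2) + M * κ ^ 2 := add_lt_add_of_lt_of_le hs le_rfl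
      _ = κ * (ε / 2 + M * κ) := by ring
      _ < κ * ε := mul_lt_mul_of_pos_left (by linarith) hκ0
  exact lt_of_mul_lt_mul_left h1 hκ0.le

/-- **Mean value in time from the zero scar of the generator** (the pattern of `stub_farFieldOfScar`): with
`‖∂ₜV‖ ≤ L₀/a³`, `‖∇∂ₜV‖ ≤ L₁/a⁴` one has `‖∂ₛ r(s,x)‖ ≤ (L₀+L₁)/‖x‖³` on `s < 0` (`r = J V − ∇V·(J·)`), whence
`‖r(t,x)‖ ≤ (L₀+L₁)(−t)/‖x‖³` for `x ≠ 0`. [folklore] -/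
theorem norm_rotDefect_le_far {V : ℝ → ℝ³ → ℝ³}
    (hsm : IsSmoothSpaceTimeOn (Iio (0 : ℝ)) V)
    {L₀ L₁ : ℝ} (hL₀ : 0 ≤ L₀) (hL₁ : 0 ≤ L₁)
    (hd : ∀ t < 0, ∀ x : ℝ³, ‖deriv (fun s => V s x) t‖ ≤ L₀ / (‖x‖ + Real.sqrt (-t)) ^ 3 ∧
      ‖fderiv ℝ (fun y => deriv (fun s => V s y) t) x‖ ≤ L₁ / (‖x‖ + Real.sqrt (-t)) ^ 4)
    (hlim : ∀ x : ℝ³, x ≠ 0 →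
      Tendsto (fun s => rotGen (V s x) - fderiv ℝ (V s) x (rotGen x)) (𝓝[<] (0 : ℝ)) (𝓝 0))
    {t : ℝ} (ht : t < 0) {x : ℝ³} (hx : x ≠ 0) :
    ‖rotGen (V t x) - fderiv ℝ (V t) x (rotGen x)‖ ≤ (L₀ + L₁) * (-t) / ‖x‖ ^ 3 := by
  have hxpos : 0 < ‖x‖ := norm_pos_iff.2 hx
  set g : ℝ → ℝ³ := fun s => rotGen (V s x) - fderiv ℝ (V s) x (rotGen x) with hg
  -- the time line `g` is differentiable on `s < 0`, with derivative bounded by `(L₀+L₁)/‖x‖³`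
  have hderiv : ∀ s ∈ Iio (0 : ℝ), HasDerivWithinAt g
      (rotGen (deriv (fun σ => V σ x) s) - fderiv ℝ (fun y => deriv (fun σ => V σ y) s) x (rotGen x)) (Iio 0) s := by
    intro s hs
    have h1 : HasDerivAt (fun σ => rotGen (V σ x)) (rotGen (deriv (fun σ => V σ x) s)) s := by
      simpa [Function.comp_def] using
        rotGenL.hasFDerivAt.comp_hasDerivAt s (hsm.hasDerivAt_timeLine isOpen_Iio hs x)
    exact (h1.sub (hsm.hasDerivAt_fderiv_slice isOpen_Iio hs x (rotGen x))).hasDerivWithinAt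
  have hbound : ∀ s ∈ Iio (0 : ℝ),
      ‖rotGen (deriv (fun σ => V σ x) s) - fderiv ℝ (fun y => deriv (fun σ => V σ y) s) x (rotGen x)‖
        ≤ (L₀ + L₁) / ‖x‖ ^ 3 := by
    intro s hs
    obtain ⟨hd0, hd1⟩ := hd s hs x
    have hρ : ‖x‖ ≤ ‖x‖ + Real.sqrt (-s) := le_add_of_nonneg_right (Real.sqrt_nonneg _)
    have e0 : ‖rotGen (deriv (fun σ => V σ x) s)‖ ≤ L₀ / ‖x‖ ^ 3 := (norm_rotGen_le_norm _).trans
      (hd0.trans (div_le_div_of_nonneg_left hL₀ (pow_pos hxpos 3) (pow_le_pow_left₀ hxpos.le hρ 3)))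
    have e1 : ‖fderiv ℝ (fun y => deriv (fun σ => V σ y) s) x (rotGen x)‖ ≤ L₁ / ‖x‖ ^ 3 := by
      calc _ ≤ ‖fderiv ℝ (fun y => deriv (fun σ => V σ y) s) x‖ * ‖rotGen x‖ :=
            ContinuousLinearMap.le_opNorm _ _
        _ ≤ L₁ / ‖x‖ ^ 4 * ‖x‖ := mul_le_mul (hd1.trans (div_le_div_of_nonneg_left hL₁ (pow_pos hxpos 4)
            (pow_le_pow_left₀ hxpos.le hρ 4))) (norm_rotGen_le_norm x) (norm_nonneg _) (by positivity)
        _ = L₁ / ‖x‖ ^ 3 := by field_simp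
    calc _ ≤ ‖rotGen (deriv (fun σ => V σ x) s)‖ + ‖fderiv ℝ (fun y => deriv (fun σ => V σ y) s) x (rotGen x)‖ :=
          norm_sub_le _ _
      _ ≤ L₀ / ‖x‖ ^ 3 + L₁ / ‖x‖ ^ 3 := add_le_add e0 e1
      _ = (L₀ + L₁) / ‖x‖ ^ 3 := (add_div _ _ _).symm
  -- mean value inequality on `Iio 0`, then `s ↑ 0`
  have hmv : ∀ s ∈ Iio (0 : ℝ), ‖g s - g t‖ ≤ (L₀ + L₁) / ‖x‖ ^ 3 * ‖s - t‖ := fun s hs =>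
    (convex_Iio (0 : ℝ)).norm_image_sub_le_of_norm_hasDerivWithin_le hderiv hbound ht hs
  have hlhs : Tendsto (fun s => ‖g s - g t‖) (𝓝[<] 0) (𝓝 ‖(0 : ℝ³) - g t‖) :=
    ((hlim x hx).sub_const _).norm
  have hrhs : Tendsto (fun s : ℝ => (L₀ + L₁) / ‖x‖ ^ 3 * ‖s - t‖) (𝓝[<] 0)
      (𝓝 ((L₀ + L₁) / ‖x‖ ^ 3 * ‖(0 : ℝ) - t‖)) :=
    ((tendsto_id.sub_const t).norm.const_mul _).mono_left nhdsWithin_le_nhds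
  have hle := le_of_tendsto_of_tendsto hlhs hrhs (eventually_mem_nhdsWithin.mono hmv)
  simp only [zero_sub, norm_neg, Real.norm_eq_abs, abs_of_neg ht] at hle
  calc ‖g t‖ ≤ (L₀ + L₁) / ‖x‖ ^ 3 * -t := hle
    _ = (L₀ + L₁) * (-t) / ‖x‖ ^ 3 := div_mul_eq_mul_div _ _ _

/-- **STUB S3a — an axisymmetric scar makes the rotation generator flat.**  If every rotation conjugate
`R_θ V(·, R_{−θ}·)` of the smooth apex profile `V` has the same scar, the rotation generator `J V − ∇V·(J x)`
(`J = rotGen = (d/dθ) R_θ|₀`) obeys `‖J V(t,x) − ∇V(t,x)·(Jx)‖ ≤ K(−t)/(‖x‖+√(−t))³` on the whole slab: the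
generator has zero scar (`tendsto_rotDefect`), the mean value inequality in time with the first time derivatives
of the package gives `(L₀+L₁)(−t)/‖x‖³` off the parabolic core, and the apex bounds give `(L₀+L₁)/(‖x‖+√(−t))`
on the core; both are `≤ 8(L₀+L₁)(−t)/(‖x‖+√(−t))³`. [folklore] -/
theorem stub_rotationGeneratorFlat :
    ∀ (V : ℝ → ℝ³ → ℝ³) (Q : ℝ → ℝ³ → ℝ) (C : ℝ), 0 < C →
      IsTypeIAncientMild C V → HasTypeIDecay C V → IsClassicalNSSolutionOn (Iio (0 : ℝ)) 1 0 V Q →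
      ScaleInvariantBounds V Q → (∀ θ : ℝ, SameScar (fun t x => rotZ θ (V t (rotZ (-θ) x))) V) →
      ∃ K : ℝ, ∀ t < 0, ∀ x : ℝ³,
        ‖rotGen (V t x) - fderiv ℝ (V t) x (rotGen x)‖ ≤ K * ((-t) / (‖x‖ + Real.sqrt (-t)) ^ 3) := by
  intro V Q C _ _ _ hcl hB hax
  have hsm : IsSmoothSpaceTimeOn (Iio (0 : ℝ)) V := hcl.smooth_velocity
  obtain ⟨L₀, L₁, L₂, hL₀, hL₁, hL₂, hb⟩ := package_orders_le_two hsm hB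
  have hlim : ∀ x : ℝ³, x ≠ 0 →
      Tendsto (fun s => rotGen (V s x) - fderiv ℝ (V s) x (rotGen x)) (𝓝[<] (0 : ℝ)) (𝓝 0) :=
    fun x hx => tendsto_rotDefect hsm hL₀ hL₁ hL₂ (fun t ht y => (hb t ht y).1) hax hx
  refine ⟨8 * (L₀ + L₁), fun t ht x => ?_⟩
  have hL : 0 ≤ L₀ + L₁ := add_nonneg hL₀ hL₁
  have hnt : 0 < -t := neg_pos.2 ht
  have hσ : 0 < Real.sqrt (-t) := Real.sqrt_pos.2 hnt
  have hσ2 : Real.sqrt (-t) ^ 2 = -t := Real.sq_sqrt hnt.le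
  obtain ⟨⟨hb0, hb1, -⟩, -⟩ := hb t ht x
  set a : ℝ := ‖x‖ + Real.sqrt (-t) with ha
  have ha0 : 0 < a := add_pos_of_nonneg_of_pos (norm_nonneg _) hσ
  rcases le_or_gt (Real.sqrt (-t)) ‖x‖ with hfar | hcore
  · -- off the core: the mean value inequality in time, and `a ≤ 2‖x‖`
    have hxpos : 0 < ‖x‖ := hσ.trans_le hfar
    have h1 := norm_rotDefect_le_far hsm hL₀ hL₁ (fun s hs y => (hb s hs y).2) hlim ht (norm_pos_iff.1 hxpos)
    have ha3 : a ^ 3 ≤ 8 * ‖x‖ ^ 3 := by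
      calc a ^ 3 ≤ (2 * ‖x‖) ^ 3 := pow_le_pow_left₀ ha0.le (by rw [ha]; linarith) 3
        _ = 8 * ‖x‖ ^ 3 := by ring
    have hinv : 1 / ‖x‖ ^ 3 ≤ 8 / a ^ 3 := by
      rw [div_le_div_iff₀ (pow_pos hxpos 3) (pow_pos ha0 3)]
      linarith
    calc _ ≤ (L₀ + L₁) * (-t) / ‖x‖ ^ 3 := h1
      _ = (L₀ + L₁) * (-t) * (1 / ‖x‖ ^ 3) := by ring
      _ ≤ (L₀ + L₁) * (-t) * (8 / a ^ 3) := mul_le_mul_of_nonneg_left hinv (mul_nonneg hL hnt.le)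
      _ = 8 * (L₀ + L₁) * (-t / a ^ 3) := by ring
  · -- on the core: the apex bounds, and `a ≤ 2√(−t)`
    have hxa : ‖x‖ ≤ a := le_add_of_nonneg_right hσ.le
    have h1 : ‖rotGen (V t x) - fderiv ℝ (V t) x (rotGen x)‖ ≤ (L₀ + L₁) / a := by
      calc _ ≤ ‖rotGen (V t x)‖ + ‖fderiv ℝ (V t) x (rotGen x)‖ := norm_sub_le _ _
        _ ≤ ‖V t x‖ + ‖fderiv ℝ (V t) x‖ * ‖rotGen x‖ :=
            add_le_add (norm_rotGen_le_norm _) (ContinuousLinearMap.le_opNorm _ _)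
        _ ≤ L₀ / a + L₁ / a ^ 2 * a := add_le_add hb0
            (mul_le_mul hb1 ((norm_rotGen_le_norm x).trans hxa) (norm_nonneg _)
              (div_nonneg hL₁ (pow_nonneg ha0.le 2)))
        _ = (L₀ + L₁) / a := by field_simp
    have hkey : 1 / a ≤ 8 * (-t / a ^ 3) := by
      rw [mul_div_assoc', div_le_div_iff₀ ha0 (pow_pos ha0 3)]
      have ha2 : a ≤ 2 * Real.sqrt (-t) := by rw [ha]; linarith
      have : a ^ 2 ≤ 4 * (-t) := by nlinarith
      nlinarith
    calc _ ≤ (L₀ + L₁) / a := h1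
      _ = (L₀ + L₁) * (1 / a) := by ring
      _ ≤ (L₀ + L₁) * (8 * (-t / a ^ 3)) := mul_le_mul_of_nonneg_left hkey hL
      _ = 8 * (L₀ + L₁) * (-t / a ^ 3) := by ring

end Summit.NavierStokesRegularity.NavierStokesRegularity.Theorems.RellichScarScarRigidity

end
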